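import Literature.NumberTheory.Automorphic.U21AnalyticVectors
import HarnessLib

/-!
# F0-P2a · S2⁺ sub-stub L2D — the by-name closer `stub_L2d_holds` (hand F0P2a-p02)

Crux `H413` = `stmt-HodgeConjecture-24833` (route `HCCMUnconditional`), line `Cruxes/H413/Lines/F0_P2aCohIsotypicLine.lean`
(stub S2⁺ `stub_archOrth_hol`, split in ED. 3/4 into `stub_L2a … stub_L2e`).  The lead's composition
`F0P2aArchOrthHol.archOrthHol_of_cuts hA hBi hBii hC hD hE` (`F0/P2a/F0P2a-p01/F0P2aArchOrthHolOfCuts.v1.lean`, ll. 103–121)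
takes as `hD` the universally closed (universe-`0`, ruling v3.2) statement of
★ `Literature.NumberTheory.Automorphic.analyticAt_inner_rightRegular_toLp_of_u21_null_of_mem_lieSpan` (p796713): Nelson–
Harish-Chandra analyticity of the matrix coefficients `t ↦ ⟪u, R(ι(exp tX)) [f]⟫` of every element of the `𝔤`-span of a
finite-dimensional `𝔨`-stable `𝔭⁻`-null subspace `V` of an `L²`-Lie-stable space of `ι`-smooth functions, for ANY adelic group datum
`𝒢`, continuous `ι : U(2,1) →* G(𝔸_K)` and automorphic `μ`.  This file states that binder TOKEN FOR TOKEN as `stub_L2d_holds` and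
proves it by the Literature theorem (the registered `stub_L2d : L2dType` then folds as `:= F0P2aStubL2dNelson.stub_L2d_holds`).

HC_CM is proved only modulo the printed citations until rung 0 closes.  No `sorry`, no definition.
References: [HarishChandraTAMS1953] Lemma 34; [Nelson1959] §8.
-/

set_option autoImplicit false
-- the mandated namespace repeats `HodgeConjecture.HodgeConjecture`, as in every `Theorems/*.lean` of this sub-problem
set_option linter.dupNamespace false

noncomputable section

open scoped Matrix MatrixGroups Topology InnerProductSpace ENNReal ComplexConjugate ComplexOrder
open MeasureTheory NumberField
open Literature.NumberTheory.Automorphic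
open Literature.Geometry.ComplexHyperbolic Literature.Geometry.ComplexHyperbolic.BallModel
open Literature.AlgebraicGeometry.ShimuraVarieties Literature.AlgebraicGeometry.ShimuraVarieties.BallForms

namespace Summit.HodgeConjecture.HodgeConjecture.Cruxes.H413.F0P2aStubL2dNelson

/-- **L2D (Nelson analyticity on `U(2,1)`; the `hD` binder of `archOrthHol_of_cuts`, token for token).**  For any adelic group
datum `𝒢` (universe `0`), automorphic `μ`, continuous `ι : U(2,1) →* G(𝔸_K)`, any `L²`-Lie-stable space `W` of `ι`-smooth functions
(Lie-stable, `L²`-representable, injective class map), any finite-dimensional `V ≤ W` stable under `lieDeriv ι Y`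
(`Y ∈ 𝔨 = u21Group.compactLie`) with `X_{ib} ψ = c • X_b ψ` on `V` (`c² = -1`), every `φ` in the complex span of the iterated Lie
derivatives of elements of `V` and every `f ∈ ℒ²(μ)` with `invQuot f = φ`: `t ↦ ⟪u, R(ι(exp tX)) [f]⟫` is real analytic at every `t₀`.
Proof: ★ `analyticAt_inner_rightRegular_toLp_of_u21_null_of_mem_lieSpan`.
[cite: HarishChandraTAMS1953, Lemma 34 (p. 228)] [cite: Nelson1959, §8] -/
theorem stub_L2d_holds :
    ∀ {K : Type} [Field K] [NumberField K] {𝒢 : AdelicGroupData.{0} K}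
      {μ : Measure 𝒢.automorphicQuotient} [𝒢.IsAutomorphicMeasure μ] (ι : ↥U21 →* 𝒢.Adelic), Continuous ι →
      ∀ {W : Submodule ℂ (𝒢.Adelic → ℂ)},
      (∀ φ ∈ W, IsArchSmooth (H := u21Group) ι φ) →
      (∀ X : u21Group.lie, ∀ φ ∈ W, lieDeriv (H := u21Group) ι X φ ∈ W) →
      ∀ (hrep : W ≤ 𝒢.l2Representable μ),
      (∀ (φ : 𝒢.Adelic → ℂ) (hφ : φ ∈ W), 𝒢.l2ClassOf μ ⟨φ, hrep hφ⟩ = 0 → φ = 0) →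
      ∀ (V : Submodule ℂ (𝒢.Adelic → ℂ)) [FiniteDimensional ℂ V], V ≤ W →
      (∀ Y : u21Group.lie, (Y : Matrix (Fin 3) (Fin 3) ℂ) ∈ u21Group.compactLie →
        ∀ ψ ∈ V, lieDeriv (H := u21Group) ι Y ψ ∈ V) →
      ∀ (c : ℂ), c * c = -1 →
      (∀ ψ ∈ V, ∀ b : Fin 2 → ℂ,
        lieDeriv (H := u21Group) ι (liePMat (Complex.I • b)) ψ = c • lieDeriv (H := u21Group) ι (liePMat b) ψ) →
      ∀ {φ : 𝒢.Adelic → ℂ},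
      φ ∈ Submodule.span ℂ {χ | ∃ (l : List u21Group.lie) (ψ : 𝒢.Adelic → ℂ), ψ ∈ V ∧ χ = iterLieDeriv (H := u21Group) ι l ψ} →
      ∀ {f : 𝒢.automorphicQuotient → ℂ} (hf : MemLp f 2 μ), invQuot 𝒢 f = φ →
      ∀ (X : u21Group.lie) (u : 𝒢.L2 μ) (t₀ : ℝ),
        AnalyticAt ℝ (fun t : ℝ => ⟪u, 𝒢.rightRegular μ (ι (u21Group.expMem (t • X))) (hf.toLp f)⟫_ℂ) t₀ := by
  intro K _ _ 𝒢 μ _ ι hι W hsm hlie hrep hinj V _ hVW hVK c hc hnull φ hφ f hf hfφ X u t₀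
  exact analyticAt_inner_rightRegular_toLp_of_u21_null_of_mem_lieSpan ι hι hsm hlie hrep hinj V hVW hVK c hc hnull
    hφ hf hfφ X u t₀

end Summit.HodgeConjecture.HodgeConjecture.Cruxes.H413.F0P2aStubL2dNelson

end
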